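import Summits.ABC.ABC.Theses.DefiniteXi
import Summits.ABC.ABC.Theorems.DefiniteXiFreyModularityIsModular
import Literature.NumberTheory.Automorphic.CDTTheorem712
import Literature.NumberTheory.Automorphic.CDTTheorem722
import Literature.NumberTheory.Automorphic.BCDTTheoremB
import Literature.NumberTheory.Automorphic.ThorneQInfinityModularTheorem2Proofs
import Literature.NumberTheory.EllipticCurves.SemistableModPImageIrreducibleProofs
import Literature.NumberTheory.EllipticCurves.SerreOpenImageDeterminantProofs
import Literature.NumberTheory.EllipticCurves.ThreeTorsionRadicalProofs
import Literature.NumberTheory.EllipticCurves.DivisionFieldDegreeProofs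
import Mathlib.FieldTheory.KummerPolynomial
import Literature.NumberTheory.EllipticCurves.CongruentNumberCurveIsModular
import Literature.NumberTheory.EllipticCurves.LFunctionSmulProofs
import Literature.NumberTheory.EllipticCurves.SzpiroOfAbcProofs
import Literature.NumberTheory.EllipticCurves.SzpiroFreyConductorProofs
import Literature.NumberTheory.EllipticCurves.Szpiro
import Literature.NumberTheory.DiophantineGeometry.GeneralizedFermatTwoPowerCoefficientExponentThree
import Mathlib.RingTheory.Polynomial.RationalRoot
import HarnessLib

/-!
# Stub ideas for `stub_modThree` — ideator k = 3, GENERATION 12 (home family 3: probe the extremes)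

Typed companion of `STUB-IDEAS-stub_modThree-3.md` (gen 12).  Nothing here is registered; the
skeleton `Lines/Sketch.lean` is untouched.

**The gen-12 finding (extremal configuration of the USE-SITE).**  The skeleton consumes
`stub_modThree` (= Langlands–Tunnell at `ρ̄_{E,3}`, every elliptic `E/ℚ`, every absolutely
irreducible framed `ρ̄`) only as `hmod3` of `liftThree_of_stubs`, i.e. inside `h1` of
`isModular_freyCurve_of_stubs`, at two kinds of curves: the Frey curve `E_(a,b)` itself in case A
(some framed `ρ̄_{E,3}` absolutely irreducible over `ℚ(√-3)`), and the switch partner `E'` in case B.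
At both places the image of `ρ̄` is (or can be taken) ALL of `GL₂(𝔽₃)`:

* case A, `(a, b)` off the CM corner `{|a|,|b|,|a+b|} = {1,1,2}`: `ρ̄_{E,3}` irreducible (case A) and
  `Δ(E_(a,b)) = 16(ab(a+b))²` NOT a rational cube (G2: a cube forces `ab(a+b) = 2w³`, the odd members
  of the coprime triple are cubes and the even one is twice a cube, i.e. Euler's `x³ + y³ = 2z³`,
  `eq_or_eq_zero_of_cube_add_cube_eq_two_mul_cube` — only the corner survives), so `ℚ(E[3]) ⊇ ℚ(∛Δ)`
  has degree divisible by `3` (G1, Serre 1972 §5.3; the tree's `zeta_mem_and_delta_mem_xDivisionField_three`),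
  so the image contains `SL₂(𝔽₃)` (G3 = Serre's Prop. 15, the tree's
  `not_dvd_card_of_not_hasSurjectiveModNGaloisRep`) and is everything (`det = χ̄₃` onto);
* case A at the corner: `E ≅ (y² = x³ - x)` (conductor `32`, `j = 1728`, image `N_ns(3)`), which the
  tree proves modular UNCONDITIONALLY (`Tunnell1983.isModular_congruentNumberCurve_one`; G4);
* case B: take Wiles' switch in the Shepherd-Barron–Taylor form the tree already names
  (`BCDT.exists_isTorsionGaloisRep_five_and_surjective_three`: `ρ̄_{E',3}` SURJECTIVE), of which the
  registered `stub_switch` is the proved weakening.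

Hence the line needs Langlands–Tunnell only for SURJECTIVE `ρ̄ : Γ_ℚ ↠ GL₂(𝔽₃)` coming from elliptic
curves — Tunnell's octahedral case proper (`SigStubModThreeSurj`, implied by the registered stub:
`sigStubModThreeSurj_of_sigStubModThree`) — and the kernel-checked composition
`FreyModularity_of_surj` below concludes the crux BY NAME from {G1, G2, G3, G4 (ALL FOUR PROVED in
this file, no `sorry`), `SigStubModThreeSurj`, the skeleton's S1b/S2/S9, the SBT switch} and three
theorems of the tree quoted as hypotheses (`isIrreducible_freyCurve_five`, `stub_absIrrSqrtFive`,
`stub_nineTransfer` — their modules are not importable on the farm snapshot).  The headline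
corollary is `FreyModularity_of_stub_modThreeSurj`: the crux from F‴ + the registered S1b/S2/S9 +
the SBT-form switch, with G1–G4 discharged.  This file has NO `sorry`.
-/

set_option linter.dupNamespace false

noncomputable section

open scoped MatrixGroups NumberField IntermediateField
open NumberField IsDedekindDomain
open Literature.NumberTheory.EllipticCurves
open Literature.NumberTheory.EllipticCurves.ModularForms
open Literature.NumberTheory.EllipticCurves.Tunnell1983
open Literature.NumberTheory.Automorphic
open Literature.NumberTheory.Automorphic.BCDT
open Literature.NumberTheory.GaloisRepresentations
open Summit.ABC.ABC.Theorems
open WeierstrassCurve Matrix Field Polynomial CongruenceSubgroup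

namespace Summit.ABC.ABC.Cruxes.FreyModularity.StubIdeasModThree3G12

/-! ## §0 The registered stub and its surjective shadow -/

/-- The statement of `stub_modThree` (verbatim, `Lines/Sketch.lean` l.143). -/
abbrev SigStubModThree : Prop :=
  ∀ (W : WeierstrassCurve ℚ) [W.IsElliptic] (ρ : ModPGaloisRep ℚ (ZMod 3) 2),
    W.IsTorsionGaloisRep 3 ρ → FramedRep.IsAbsolutelyIrreducible ρ → ρ.IsModular

/-- **F‴ — the stub at SURJECTIVE `ρ̄` only** (Tunnell 1981, the octahedral case: projective image
`S₄`): for `E/ℚ` and a framed model `ρ̄` of `E[3]` ONTO `GL₂(𝔽₃)`, `ρ̄` is modular.  All the line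
consumes (see `FreyModularity_of_surj`). [cite: Tunnell1981] [cite: BCDTJAMS2001, §2.2 (p. 862)] -/
abbrev SigStubModThreeSurj : Prop :=
  ∀ (W : WeierstrassCurve ℚ) [W.IsElliptic] (ρ : ModPGaloisRep ℚ (ZMod 3) 2),
    W.IsTorsionGaloisRep 3 ρ → Function.Surjective ρ → ρ.IsModular

/-- The registered stub implies its surjective shadow (surjective ⇒ absolutely irreducible over
`ℚ(√-3)` ⇒ absolutely irreducible: `isAbsIrreducibleOverSqrt_neg_three_of_surjective`). [folklore] -/
theorem sigStubModThreeSurj_of_sigStubModThree (h : SigStubModThree) : SigStubModThreeSurj :=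
  fun W _ ρ hρ hs ↦
    h W ρ hρ (isAbsIrreducibleOverSqrt_neg_three_of_surjective ρ hs).isAbsolutelyIrreducible

/-! ## §1 The four helper lemmas G1–G4 -/

/-- **The CM corner of the Frey family**: `{|a|, |b|, |a+b|} = {1, 1, 2}`, i.e. `ab(a+b) = ±2`, i.e.
`(a, b) ∈ {(1,1), (-1,-1), (1,-2), (2,-1), (-1,2), (-2,1)}`; the curves are the three models
`x³ - x`, `x(x-1)(x-2)`, `x(x+1)(x+2)` of `y² = x³ - x` (`32a2`, `j = 1728`). [folklore] -/
def Corner (a b : ℤ) : Prop := (a * b * (a + b)) ^ 2 = 4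

example : Corner 1 1 ∧ Corner (-1) (-1) ∧ Corner 1 (-2) ∧ Corner 2 (-1) ∧ Corner (-1) 2 ∧
    Corner (-2) 1 ∧ ¬ Corner 2 1 ∧ ¬ Corner 1 (-3) := by unfold Corner; norm_num

/-- At the corner the discriminant IS a cube (`Δ(E_(1,1)) = 64 = 4³`): G1–G3 give nothing there,
which is why G4 is needed. [folklore] -/
example : (freyCurve 1 1).Δ = 4 ^ 3 := by rw [freyCurve_Δ]; norm_num

/-- The corner model `E_(1,1)` is literally the congruent number curve `E₁ : y² = x³ - x`. [folklore] -/
example : freyCurve 1 1 = congruentNumberCurve 1 := by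
  ext <;> simp [freyCurve, congruentNumberCurve]

/-- **The corner is six pairs** (`a ∣ 4`, `b ∣ 4`, finite check) — the first step of G4, PROVED. [folklore] -/
theorem corner_cases {a b : ℤ} (h : Corner a b) :
    (a = 1 ∧ b = 1) ∨ (a = -1 ∧ b = -1) ∨ (a = 1 ∧ b = -2) ∨ (a = 2 ∧ b = -1) ∨
      (a = -1 ∧ b = 2) ∨ (a = -2 ∧ b = 1) := by
  unfold Corner at h
  have ha : a ∣ 4 := ⟨a * (b * (a + b)) ^ 2, by rw [← h]; ring⟩
  have hb : b ∣ 4 := ⟨b * (a * (a + b)) ^ 2, by rw [← h]; ring⟩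
  have ha1 : a ≤ 4 := Int.le_of_dvd (by norm_num) ha
  have ha2 : -4 ≤ a := by have := Int.le_of_dvd (by norm_num) (neg_dvd.mpr ha); omega
  have hb1 : b ≤ 4 := Int.le_of_dvd (by norm_num) hb
  have hb2 : -4 ≤ b := by have := Int.le_of_dvd (by norm_num) (neg_dvd.mpr hb); omega
  interval_cases a <;> interval_cases b <;> revert h <;> decide

/-- The six corner pairs give THREE Weierstrass models (the sign flip `(a, b) ↦ (-b, -a)` fixes
`freyCurve`): `⟨0,0,0,-1,0⟩ = E₁`, `⟨0,-3,0,2,0⟩`, `⟨0,3,0,2,0⟩`. [folklore] -/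
example : freyCurve (-1) (-1) = freyCurve 1 1 ∧ freyCurve 2 (-1) = freyCurve 1 (-2) ∧
    freyCurve (-1) 2 = freyCurve (-2) 1 := by
  refine ⟨?_, ?_, ?_⟩ <;> ext <;> simp [freyCurve] <;> norm_num

/-- … all three are translates of `E₁ : y² = x³ - x` (`x ↦ x ± 1`; the `+1` one is the tree's
`congruentNumberCurve_one_eq_smul_freyCurve`), so G4 is `Tunnell1983.isModular_congruentNumberCurve_one`
transported along `isModular_smul_iff`. [folklore] -/
example : congruentNumberCurve 1 = (⟨1, -1, 0, 0⟩ : VariableChange ℚ) • freyCurve (-2) 1 ∧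
    congruentNumberCurve 1 = (⟨1, 1, 0, 0⟩ : VariableChange ℚ) • freyCurve 1 (-2) := by
  refine ⟨?_, congruentNumberCurve_one_eq_smul_freyCurve⟩
  ext <;> simp [freyCurve, congruentNumberCurve, variableChange_def] <;> norm_num

/-- **G1 (helper, S–M) — `ℚ(E[3]) ⊇ ℚ(∛Δ)`: a non-cube discriminant puts an element of order `3`
in the mod-`3` image** (Serre 1972, §5.3).  Proof route, all in the tree: radical data over `ℚ̄`
(`exists_radical` for `W.baseChange ℚ̄`, invariants by `baseChange_algebraicClosure_invariants`);
`δ ∈ ℚ(x(E[3]))` (`zeta_mem_and_delta_mem_xDivisionField_three`); `ker ρ̄_{E,3} ≤ Γ_{ℚ(x(E[3]))}`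
(`mem_ker_galoisRepTorsion_iff'` / `mem_fixingSubgroupOfModule_geomTorsion_iff`,
`fixingSubgroupOfModule_le_xFixingSubgroup`, `fixingSubgroup_xDivisionField`), hence
`ker ρ̄ ≤ Γ_{ℚ(δ)}` and `[ℚ(δ):ℚ] ∣ [Γ_ℚ : ker ρ̄] = #ρ̄(Γ_ℚ)`
(`IntermediateField.finrank_eq_fixingSubgroup_index`, `Subgroup.index_dvd_of_le`,
`Subgroup.index_ker` — cf. the proof of `finrank_dvd_of_ker_galoisRepTorsion_le_fixingSubgroup`);
and `[ℚ(δ):ℚ] = 3` since `X³ - Δ` has no rational root (`IntermediateField.adjoin.finrank`,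
`Polynomial.Monic.irreducible_iff_roots_eq_zero_of_degree_le_three`).
Cheapest falsifier: none — it is a theorem (Serre §5.3); sanity: `32a2` has `Δ = 4³` and image
`N_ns(3)` of order `16`. [cite: Serre1972, §5.3] -/
abbrev SigThreeDvdCardOfΔNeCube : Prop :=
  ∀ (W : WeierstrassCurve ℚ) [W.IsElliptic], (∀ d : ℚ, W.Δ ≠ d ^ 3) →
    3 ∣ Nat.card (W.galoisRepTorsion 3).range

/-- **G2 (helper, S–M) — a Frey curve with cube discriminant is a corner curve.**
`16(ab(a+b))² = d³` with `d ∈ ℚ` forces `d ∈ ℤ` and `ab(a+b) = 2w³` (compare `p`-adic valuations: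
`2 v_p(c) ≡ 0`, `4 + 2 v₂(c) ≡ 0 (mod 3)`); `a, b, a+b` pairwise coprime, so the two odd members are
cubes (up to sign, absorbed) and the even one is `2·(cube)`: `x³ + y³ = 2z³`, whence `x = y` or
`z = 0` by Euler (`eq_or_eq_zero_of_cube_add_cube_eq_two_mul_cube`, tree,
`GeneralizedFermatTwoPowerCoefficientExponentThree`), i.e. `{a, b} = {1,1}, {-1,-1}` or
`{a, b} ∋ ∓2, ±1` — the corner.  Tools: `freyCurve_Δ`, `Int.eq_pow_of_mul_eq_pow_odd_left/right`-type
coprime splitting (`Int.sq_of_coprime`, `exists_associated_pow_of_mul_eq_pow`), `multiplicity`.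
Cheapest falsifier: a coprime pair off the corner with `16(ab(a+b))²` a cube — impossible by the
valuation count unless `ab(a+b) = 2w³`, and then Euler. [cite: Euler1770Algebra, Part II Ch. XV Art. 247] -/
abbrev SigCornerOfΔFreyCurveEqCube : Prop :=
  ∀ a b : ℤ, IsCoprime a b → a * b * (a + b) ≠ 0 →
    (∃ d : ℚ, (freyCurve a b).Δ = d ^ 3) → Corner a b

/-- **G3 (glue, S) — irreducible + an element of order `3` ⇒ onto `GL₂(𝔽₃)`** (Serre 1972 Prop. 15
with (iii): a subgroup of `GL₂(𝔽_p)` of order divisible by `p` is Borel or contains `SL₂(𝔽_p)`;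
`det ρ̄_{E,3} = χ̄₃` is onto `𝔽₃ˣ`).  PROVED below from the tree's
`not_dvd_card_of_not_hasSurjectiveModNGaloisRep` on a frame (`exists_frame_galoisRepTorsion_rat`,
`card_map_range_galoisRepTorsion`). [cite: Serre1972, §2.4 Prop. 15; §5.4] -/
abbrev SigSurjectiveOfThreeDvdCard : Prop :=
  ∀ (W : WeierstrassCurve ℚ) [W.IsElliptic], W.HasIrreducibleModPGaloisRep 3 →
    3 ∣ Nat.card (W.galoisRepTorsion 3).range → W.HasSurjectiveModNGaloisRep 3

/-- **G4 (helper, S) — the six corner curves are modular, unconditionally.**  From `Corner a b`,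
`corner_cases` (PROVED above) gives `(a, b) ∈ {(1,1), (-1,-1), (1,-2), (2,-1), (-1,2), (-2,1)}`;
the three resulting models are `E₁ = congruentNumberCurve 1`
(`(±1, ±1)`, `rfl` after `ext; simp`), `⟨1,1,0,0⟩⁻¹ • E₁` (`(1,-2)`, `(2,-1)`:
`congruentNumberCurve_one_eq_smul_freyCurve`) and the translate `x ↦ x - 1` (`(-1,2)`, `(-2,1)`:
`congruentNumberCurve 1 = ⟨1,-1,0,0⟩ • freyCurve (-2) 1`, `ext <;> simp <;> ring`); conclude by
`Tunnell1983.isModular_congruentNumberCurve_one` and `isModular_smul_iff` (conductor transport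
`conductorNorm_smul_rat`, `neZero_conductorNorm_congruentNumberCurve_one`).  The `(1,-2)` case in
the crux's datum form is already LANDED (`stub_freyModularityCorner`). [cite: Tunnell1983Congruent, p. 325]
[cite: BCDTJAMS2001, Introduction, condition (2)] -/
abbrev SigIsModularFreyCurveCorner : Prop :=
  ∀ a b : ℤ, Corner a b → ∀ [NeZero ((freyCurve a b).conductorNorm ℤ)], BCDT.IsModular (freyCurve a b)

/-- **G1 in general — `Δ ∉ K³ ⇒ 3 ∣ #ρ̄_{E,3}(Γ_K)`** (`K` a number field): `∛Δ ∈ K(x(E[3]))`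
(tree: `zeta_mem_and_delta_mem_xDivisionField_three`), `ker ρ̄ ≤ Γ_{K(E[3])} ≤ Γ_{K(x(E[3]))} ≤ Γ_{K(∛Δ)}`,
and `3 = [K(∛Δ):K] = [Γ_K : Γ_{K(∛Δ)}] ∣ [Γ_K : ker ρ̄] = #ρ̄(Γ_K)` (Kummer: `X³ - Δ` irreducible).
PROVED. [cite: Serre1972, §5.3] -/
theorem three_dvd_card_range_galoisRepTorsion_of_Δ_ne_cube {K : Type} [Field K] [NumberField K]
    (W : WeierstrassCurve K) [W.IsElliptic] (hΔ : ∀ d : K, W.Δ ≠ d ^ 3) :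
    3 ∣ Nat.card (W.galoisRepTorsion ((3 : ℕ) : ℤ)).range := by
  -- radical data for `E[3]` over `K̄`
  obtain ⟨ζ, δ, R₀, R₁, R₂, hζ, hδ, h₀, h₁, h₂, hR⟩ :=
    (W.baseChange (AlgebraicClosure K)).exists_radical
  obtain ⟨-, ec₄, ec₆, eΔ⟩ := W.baseChange_algebraicClosure_invariants
  rw [eΔ] at hδ
  rw [ec₄] at h₀ h₁ h₂
  rw [ec₆] at hR
  -- `∛Δ ∈ K(x(E[3]))`
  have hδmem : δ ∈ W.xDivisionField 3 :=
    (W.zeta_mem_and_delta_mem_xDivisionField_three two_ne_zero three_ne_zero hζ hδ h₀ h₁ h₂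
      hR).2
  -- `ker ρ̄_{E,3} ≤ Γ_{K(E[3])} ≤ Γ_{K(x(E[3]))} ≤ Γ_{K(δ)}`
  have hker₁ : (W.galoisRepTorsion ((3 : ℕ) : ℤ)).ker ≤
      fixingSubgroupOfModule K (geomTorsion W ((3 : ℕ) : ℤ)) := by
    intro σ hσ
    rw [mem_fixingSubgroupOfModule_geomTorsion_iff]
    intro T
    rw [← galoisRepTorsion_apply, MonoidHom.mem_ker.mp hσ]
    rfl
  have hker₂ : (W.galoisRepTorsion ((3 : ℕ) : ℤ)).ker ≤ (W.xDivisionField 3).fixingSubgroup := by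
    rw [fixingSubgroup_xDivisionField]
    exact hker₁.trans (W.fixingSubgroupOfModule_le_xFixingSubgroup 3)
  have hle : K⟮δ⟯ ≤ W.xDivisionField 3 := IntermediateField.adjoin_simple_le_iff.mpr hδmem
  have hker₃ : (W.galoisRepTorsion ((3 : ℕ) : ℤ)).ker ≤ (K⟮δ⟯).fixingSubgroup :=
    hker₂.trans (IntermediateField.fixingSubgroup_antitone hle)
  -- `[K(δ):K] = 3` (Kummer)
  have hirr : Irreducible (X ^ 3 - C W.Δ : K[X]) :=
    X_pow_sub_C_irreducible_of_prime Nat.prime_three (fun b hb ↦ hΔ b hb.symm)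
  have hint : IsIntegral K δ := Algebra.IsIntegral.isIntegral δ
  have hmin : minpoly K δ = X ^ 3 - C W.Δ := by
    refine (minpoly.eq_of_irreducible_of_monic hirr ?_ (monic_X_pow_sub_C _ three_ne_zero)).symm
    simp only [map_sub, map_pow, aeval_X, aeval_C, hδ, sub_self]
  have hdeg : Module.finrank K K⟮δ⟯ = 3 := by
    rw [IntermediateField.adjoin.finrank hint, hmin, natDegree_X_pow_sub_C]
  -- `3 = [K(δ):K] = [Γ_K : Γ_{K(δ)}] ∣ [Γ_K : ker ρ̄] = #ρ̄(Γ_K)`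
  have hdvd : Module.finrank K K⟮δ⟯ ∣ (W.galoisRepTorsion ((3 : ℕ) : ℤ)).ker.index := by
    rw [IntermediateField.finrank_eq_fixingSubgroup_index]
    exact Subgroup.index_dvd_of_le hker₃
  rw [← Subgroup.index_ker]
  exact hdeg ▸ hdvd

/-- **G1 PROVED** (`K = ℚ`). [cite: Serre1972, §5.3] -/
theorem G1_three_dvd_card_range_of_Δ_ne_cube : SigThreeDvdCardOfΔNeCube := fun W _ hΔ ↦ by
  exact_mod_cast three_dvd_card_range_galoisRepTorsion_of_Δ_ne_cube W hΔ

/-- G2, arithmetic core: `16 c² = d³` with `d ∈ ℚ`, `c ∈ ℤ ∖ {0}` forces `c = 2w³`.  Proof: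
`u := d²/(4c)` has `u³ = 4c`, so `u ∈ ℤ` (integral root theorem), `u` is even, `c = 2(u/2)³`.
[folklore] -/
theorem exists_eq_two_mul_cube {c : ℤ} (hc : c ≠ 0) {d : ℚ} (h : 16 * (c : ℚ) ^ 2 = d ^ 3) :
    ∃ w : ℤ, c = 2 * w ^ 3 := by
  have hc' : (c : ℚ) ≠ 0 := by exact_mod_cast hc
  set u : ℚ := d ^ 2 / (4 * c) with hu
  have hu3 : u ^ 3 = 4 * c := by
    have h6 : d ^ 6 = (16 * (c : ℚ) ^ 2) ^ 2 := by rw [h]; ring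
    rw [hu, div_pow, div_eq_iff (pow_ne_zero _ (mul_ne_zero four_ne_zero hc'))]
    calc (d ^ 2) ^ 3 = d ^ 6 := by ring
      _ = (16 * (c : ℚ) ^ 2) ^ 2 := h6
      _ = 4 * c * (4 * c) ^ 3 := by ring
  obtain ⟨n, hn⟩ : ∃ n : ℤ, (n : ℚ) = u := by
    have hint : IsLocalization.IsInteger ℤ u :=
      isInteger_of_is_root_of_monic (p := X ^ 3 - C (4 * c : ℤ))
        (monic_X_pow_sub_C _ three_ne_zero)
        (by simp only [map_sub, map_pow, aeval_X, aeval_C, hu3]; simp)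
    obtain ⟨n, hn⟩ := hint
    exact ⟨n, by simpa using hn⟩
  have hn3 : n ^ 3 = 4 * c := by exact_mod_cast (show (n : ℚ) ^ 3 = 4 * c by rw [hn, hu3])
  obtain ⟨w, rfl⟩ : 2 ∣ n := Int.prime_two.dvd_of_dvd_pow (n := 3) ⟨2 * c, by rw [hn3]; ring⟩
  exact ⟨w, by linarith⟩

/-- G2, even leg: `a = 2a'`, `a' · b · (a+b) = w³` with pairwise-coprime factors, so each is a cube
(`Int.eq_pow_of_mul_eq_pow_odd_left`); `t³ + (−v)³ = 2s³` and Euler give `a = −2b`, `b = ±1`.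
[cite: Euler1770Algebra, Part II Ch. XV Art. 247] -/
theorem corner_of_two_dvd {a b w : ℤ} (hab : IsCoprime a b) (h0 : a * b * (a + b) ≠ 0)
    (hw : a * b * (a + b) = 2 * w ^ 3) (ha : 2 ∣ a) : Corner a b := by
  obtain ⟨a', rfl⟩ := ha
  have h3 : Odd 3 := ⟨1, rfl⟩
  have hprod : a' * b * (2 * a' + b) = w ^ 3 :=
    mul_left_cancel₀ (two_ne_zero' ℤ) (by linear_combination hw)
  have ha'b : IsCoprime a' b := hab.of_mul_left_right
  have hac : IsCoprime (2 * a') (2 * a' + b) := by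
    rw [add_comm]; simpa using hab.add_mul_left_right 1
  have ha'c : IsCoprime a' (2 * a' + b) := hac.of_mul_left_right
  have hbc : IsCoprime b (2 * a' + b) := by simpa using hab.symm.add_mul_left_right 1
  obtain ⟨s, hs⟩ := Int.eq_pow_of_mul_eq_pow_odd_left (ha'b.mul_right ha'c) h3
    (by rw [← hprod]; ring)
  obtain ⟨v, hv⟩ := Int.eq_pow_of_mul_eq_pow_odd_left (ha'b.symm.mul_right hbc) h3
    (by rw [← hprod]; ring)
  obtain ⟨t, ht⟩ := Int.eq_pow_of_mul_eq_pow_odd_left (ha'c.symm.mul_right hbc.symm) h3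
    (by rw [← hprod]; ring)
  have key : t ^ 3 + (-v) ^ 3 = 2 * s ^ 3 := by rw [← ht]; linear_combination 2 * hs + hv
  rcases Literature.NumberTheory.DiophantineGeometry.eq_or_eq_zero_of_cube_add_cube_eq_two_mul_cube
    key with htv | hs0
  · have hab' : a' = -b := by
      have : t ^ 3 = -v ^ 3 := by rw [htv]; ring
      linarith
    subst hab'
    have hu : IsUnit b := isCoprime_self.mp (by simpa using ha'b.neg_left)
    rcases Int.isUnit_iff.mp hu with rfl | rfl <;> unfold Corner <;> norm_num
  · exfalso; apply h0; rw [hs, hs0]; ring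

/-- G2, odd leg: `a, b` odd, `a + b = 2e`, `a · b · e = w³` with pairwise-coprime factors, so
`a = v³`, `b = t³`, `e = s³`, `v³ + t³ = 2s³` and Euler give `a = b = ±1`.
[cite: Euler1770Algebra, Part II Ch. XV Art. 247] -/
theorem corner_of_odd_odd {a b w : ℤ} (hab : IsCoprime a b) (h0 : a * b * (a + b) ≠ 0)
    (hw : a * b * (a + b) = 2 * w ^ 3) (ha : Odd a) (hb : Odd b) : Corner a b := by
  obtain ⟨e, he⟩ : 2 ∣ a + b := (ha.add_odd hb).two_dvd
  have h3 : Odd 3 := ⟨1, rfl⟩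
  have hprod : a * b * e = w ^ 3 :=
    mul_left_cancel₀ (two_ne_zero' ℤ) (by rw [← hw, he]; ring)
  have hac : IsCoprime a (a + b) := by rw [add_comm]; simpa using hab.add_mul_left_right 1
  have hbc : IsCoprime b (a + b) := by simpa using hab.symm.add_mul_left_right 1
  rw [he] at hac hbc
  have hae : IsCoprime a e := hac.of_mul_right_right
  have hbe : IsCoprime b e := hbc.of_mul_right_right
  obtain ⟨v, hv⟩ := Int.eq_pow_of_mul_eq_pow_odd_left (hab.mul_right hae) h3
    (by rw [← hprod]; ring)
  obtain ⟨t, ht⟩ := Int.eq_pow_of_mul_eq_pow_odd_left (hab.symm.mul_right hbe) h3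
    (by rw [← hprod]; ring)
  obtain ⟨s, hs⟩ := Int.eq_pow_of_mul_eq_pow_odd_left (hae.symm.mul_right hbe.symm) h3
    (by rw [← hprod]; ring)
  have key : v ^ 3 + t ^ 3 = 2 * s ^ 3 := by rw [← hv, ← ht, ← hs]; exact he
  rcases Literature.NumberTheory.DiophantineGeometry.eq_or_eq_zero_of_cube_add_cube_eq_two_mul_cube
    key with hvt | hs0
  · have hab' : a = b := by rw [hv, ht, hvt]
    subst hab'
    rcases Int.isUnit_iff.mp (isCoprime_self.mp hab) with rfl | rfl <;> unfold Corner <;> norm_num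
  · exfalso; apply h0; rw [he, hs, hs0]; ring

/-- **G2 PROVED — off the corner, `Δ(E_{a,b}) = 16(ab(a+b))²` is not a rational cube.**
[cite: Euler1770Algebra, Part II Ch. XV Art. 247] -/
theorem G2_corner_of_Δ_freyCurve_eq_cube : SigCornerOfΔFreyCurveEqCube := by
  rintro a b hab h0 ⟨d, hd⟩
  rw [freyCurve_Δ] at hd
  obtain ⟨w, hw⟩ := exists_eq_two_mul_cube (c := a * b * (a + b)) h0 (d := d)
    (by push_cast; exact hd)
  rcases Int.even_or_odd a with ha | ha
  · exact corner_of_two_dvd hab h0 hw ha.two_dvd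
  rcases Int.even_or_odd b with hb | hb
  · have h0' : b * a * (b + a) ≠ 0 := by rw [show b * a * (b + a) = a * b * (a + b) by ring]; exact h0
    have hw' : b * a * (b + a) = 2 * w ^ 3 := by rw [← hw]; ring
    have := corner_of_two_dvd hab.symm h0' hw' hb.two_dvd
    unfold Corner at this ⊢
    rw [← this]; ring
  · exact corner_of_odd_odd hab h0 hw ha hb

/-- **G3 is a theorem of the tree up to a frame** (Serre Prop. 15 + (iii)). [cite: Serre1972, §5.4, proof of Prop. 21] -/
theorem hasSurjectiveModNGaloisRep_three_of_dvd_card : SigSurjectiveOfThreeDvdCard := by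
  intro W _ hirr h3
  by_contra hns
  obtain ⟨e, Φ, he, -⟩ := exists_frame_galoisRepTorsion_rat W 3
  have hns' : ¬ W.HasSurjectiveModNGaloisRep ((3 : ℕ) : ℤ) := by exact_mod_cast hns
  have key := not_dvd_card_of_not_hasSurjectiveModNGaloisRep W 3 Φ e he hirr hns'
  rw [card_map_range_galoisRepTorsion W 3 Φ] at key
  exact key (by exact_mod_cast h3)

/-- Modularity is insensitive to propositionally equal models (the `NeZero` instance is a
proof of a `Prop`). [folklore] -/
theorem isModular_congr {W W' : WeierstrassCurve ℚ} (h : W = W') [NeZero (W.conductorNorm ℤ)]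
    [NeZero (W'.conductorNorm ℤ)] : BCDT.IsModular W ↔ BCDT.IsModular W' := by
  subst h
  exact Iff.rfl

/-- `BCDT.IsModular W` read at a level `N = N_W` (copy of the tree's
`isModular_iff_exists_isNewformOf_of_eq`). [folklore] -/
theorem isModular_iff_exists_isNewformOf_of_eq' (W : WeierstrassCurve ℚ)
    [NeZero (W.conductorNorm ℤ)] {N : ℕ} [NeZero N] (h : W.conductorNorm ℤ = N) :
    BCDT.IsModular W ↔ ∃ f : CuspForm (Gamma0 N) 2, IsNewformOf W f := by
  subst h
  rfl

/-- **Modularity is a property of the curve, not the model** (copy of the tree's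
`Summit.ABC.ABC.Theorems.isModular_smul_iff`, from the Literature lemmas `conductorNorm_smul_rat` and
`LFunction_smul`). [cite: SilvermanAEC2009, App. C §16] -/
theorem isModular_smul_iff' (W : WeierstrassCurve ℚ) [W.IsElliptic] (C : VariableChange ℚ)
    [NeZero (W.conductorNorm ℤ)] [NeZero ((C • W).conductorNorm ℤ)] :
    BCDT.IsModular (C • W) ↔ BCDT.IsModular W := by
  rw [isModular_iff_exists_isNewformOf_of_eq' (C • W) (W.conductorNorm_smul_rat C)]
  refine exists_congr fun f ↦ ?_
  simp only [IsNewformOf, WeierstrassCurve.LFunction_smul]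

/-- **G4 PROVED — the six corner curves are modular, unconditionally**: each is a model of
`E₁ : y² = x³ - x` (`32a2`), modular by Tunnell 1983 (tree: `isModular_congruentNumberCurve_one`).
[cite: Tunnell1983Congruent, p. 325] -/
theorem G4_isModular_freyCurve_corner : SigIsModularFreyCurveCorner := by
  intro a b hc
  haveI := neZero_conductorNorm_congruentNumberCurve_one
  have hE₁ : BCDT.IsModular (congruentNumberCurve 1) := isModular_congruentNumberCurve_one
  have e₁ : freyCurve 1 1 = congruentNumberCurve 1 := by
    ext <;> simp [freyCurve, congruentNumberCurve]
  have e₂ : freyCurve (-1) (-1) = congruentNumberCurve 1 := by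
    ext <;> simp [freyCurve, congruentNumberCurve]
  have e₃ : congruentNumberCurve 1 = (⟨1, 1, 0, 0⟩ : VariableChange ℚ) • freyCurve 1 (-2) :=
    congruentNumberCurve_one_eq_smul_freyCurve
  have e₄ : freyCurve 2 (-1) = freyCurve 1 (-2) := by ext <;> simp [freyCurve] <;> norm_num
  have e₅ : congruentNumberCurve 1 = (⟨1, -1, 0, 0⟩ : VariableChange ℚ) • freyCurve (-2) 1 := by
    ext <;> simp [freyCurve, congruentNumberCurve, variableChange_def] <;> norm_num
  have e₆ : freyCurve (-1) 2 = freyCurve (-2) 1 := by ext <;> simp [freyCurve] <;> norm_num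
  -- the two translated models of `E₁` are modular
  have hM : ∀ [NeZero ((freyCurve 1 (-2)).conductorNorm ℤ)], BCDT.IsModular (freyCurve 1 (-2)) := by
    intro _
    haveI : (freyCurve 1 (-2)).IsElliptic := isElliptic_freyCurve (by norm_num)
    haveI : NeZero (((⟨1, 1, 0, 0⟩ : VariableChange ℚ) • freyCurve 1 (-2)).conductorNorm ℤ) :=
      e₃ ▸ neZero_conductorNorm_congruentNumberCurve_one
    exact (isModular_smul_iff' (freyCurve 1 (-2)) ⟨1, 1, 0, 0⟩).mp ((isModular_congr e₃).mp hE₁)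
  have hM' : ∀ [NeZero ((freyCurve (-2) 1).conductorNorm ℤ)],
      BCDT.IsModular (freyCurve (-2) 1) := by
    intro _
    haveI : (freyCurve (-2) 1).IsElliptic := isElliptic_freyCurve (by norm_num)
    haveI : NeZero (((⟨1, -1, 0, 0⟩ : VariableChange ℚ) • freyCurve (-2) 1).conductorNorm ℤ) :=
      e₅ ▸ neZero_conductorNorm_congruentNumberCurve_one
    exact (isModular_smul_iff' (freyCurve (-2) 1) ⟨1, -1, 0, 0⟩).mp ((isModular_congr e₅).mp hE₁)
  intro inst
  rcases corner_cases hc with ⟨rfl, rfl⟩ | ⟨rfl, rfl⟩ | ⟨rfl, rfl⟩ | ⟨rfl, rfl⟩ | ⟨rfl, rfl⟩ |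
    ⟨rfl, rfl⟩
  · exact (isModular_congr e₁).mpr hE₁
  · exact (isModular_congr e₂).mpr hE₁
  · exact hM
  · haveI : NeZero ((freyCurve 1 (-2)).conductorNorm ℤ) := e₄ ▸ inst
    exact (isModular_congr e₄).mpr hM
  · haveI : NeZero ((freyCurve (-2) 1).conductorNorm ℤ) := e₆ ▸ inst
    exact (isModular_congr e₆).mpr hM'
  · exact hM'

/-- **If `Γ_F → Aut(E[p])` is onto, every framed model `ρ̄` of `E[p]` is onto `GL₂(𝔽_p)`** — copy of
the tree's `Summit.ABC.ABC.Theorems.surjective_of_hasSurjectiveModNGaloisRep`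
(`DefiniteXiFreyModularityStubFreyCaseBThreeReducible`, whose import chain is not built on the farm at
the time of writing). [folklore] -/
theorem surjective_of_hasSurjectiveModNGaloisRep' {F : Type} [Field F] {W : WeierstrassCurve F}
    {p : ℕ} [Fact p.Prime] (hs : W.HasSurjectiveModNGaloisRep (p : ℤ)) {ρ : ModPGaloisRep F (ZMod p) 2}
    (hρ : W.IsTorsionGaloisRep p ρ) : Function.Surjective ρ := by
  obtain ⟨e, he⟩ := hρ
  intro M
  let f : (Fin 2 → ZMod p) ≃+ (Fin 2 → ZMod p) :=
    { toFun := fun v ↦ (M : Matrix (Fin 2) (Fin 2) (ZMod p)) *ᵥ v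
      invFun := fun v ↦ ((M⁻¹ : GL (Fin 2) (ZMod p)) : Matrix (Fin 2) (Fin 2) (ZMod p)) *ᵥ v
      left_inv := fun v ↦ by
        simp only [Matrix.mulVec_mulVec, Units.inv_mul, Matrix.one_mulVec]
      right_inv := fun v ↦ by
        simp only [Matrix.mulVec_mulVec, Units.mul_inv, Matrix.one_mulVec]
      map_add' := fun v w ↦ Matrix.mulVec_add _ _ _ }
  have hf : ∀ v, f v = (M : Matrix (Fin 2) (Fin 2) (ZMod p)) *ᵥ v := fun _ ↦ rfl
  obtain ⟨σ, hσ⟩ := hs (Multiplicative.ofAdd (e.trans (f.trans e.symm)))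
  have hσP : ∀ P : geomTorsion W p, σ • P = e.symm (f (e P)) := fun P ↦ by
    have h := W.galoisRepTorsion_apply (p : ℤ) σ P
    rw [hσ, toAdd_ofAdd] at h
    exact h.symm
  refine ⟨σ, ?_⟩
  have hv : ∀ v : Fin 2 → ZMod p,
      ((ρ σ : GL (Fin 2) (ZMod p)) : Matrix (Fin 2) (Fin 2) (ZMod p)) *ᵥ v =
        (M : Matrix (Fin 2) (Fin 2) (ZMod p)) *ᵥ v := fun v ↦ by
    have h := he σ (e.symm v)
    rw [hσP, AddEquiv.apply_symm_apply, AddEquiv.apply_symm_apply, hf] at h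
    exact h.symm
  have hmat : ((ρ σ : GL (Fin 2) (ZMod p)) : Matrix (Fin 2) (Fin 2) (ZMod p)) =
      (M : Matrix (Fin 2) (Fin 2) (ZMod p)) :=
    Matrix.toLin'.injective (LinearMap.ext fun v ↦ by rw [Matrix.toLin'_apply, Matrix.toLin'_apply, hv])
  exact Units.ext hmat

/-! ## §2 The use-site theorem: case A off the corner ⇒ `ρ̄_{E,3}` onto `GL₂(𝔽₃)` -/

/-- **Off the corner, an irreducible framed `ρ̄_{E_(a,b),3}` is SURJECTIVE** (G1 + G2 + G3, through
the tree's frame transports `hasIrreducibleModPGaloisRep_of_isIrreducible` and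
`surjective_of_hasSurjectiveModNGaloisRep`). [cite: Serre1972, §5.3–5.4] -/
theorem surjective_of_isIrreducible_freyCurve_three (hG1 : SigThreeDvdCardOfΔNeCube)
    (hG2 : SigCornerOfΔFreyCurveEqCube) (hG3 : SigSurjectiveOfThreeDvdCard) {a b : ℤ}
    (hab : IsCoprime a b) (h0 : a * b * (a + b) ≠ 0) (hc : ¬ Corner a b)
    {ρ : ModPGaloisRep ℚ (ZMod 3) 2} (hρ : (freyCurve a b).IsTorsionGaloisRep 3 ρ)
    (hirr : FramedRep.IsIrreducible ρ) : Function.Surjective ρ := by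
  haveI := isElliptic_freyCurve h0
  have hI : (freyCurve a b).HasIrreducibleModPGaloisRep 3 :=
    Thorne2016.hasIrreducibleModPGaloisRep_of_isIrreducible hρ hirr
  have hΔ : ∀ d : ℚ, (freyCurve a b).Δ ≠ d ^ 3 := fun d hd ↦ hc (hG2 a b hab h0 ⟨d, hd⟩)
  have hS : (freyCurve a b).HasSurjectiveModNGaloisRep 3 :=
    hG3 (freyCurve a b) hI (hG1 (freyCurve a b) hΔ)
  exact surjective_of_hasSurjectiveModNGaloisRep' (p := 3) (by exact_mod_cast hS) hρ

/-! ## §3 The compositions with the surjective stub -/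

/-- **`h1` at surjective `ρ̄`**: the skeleton's `liftThree_of_stubs` with `hmod3` weakened to
`SigStubModThreeSurj` (surjective ⇒ absolutely irreducible over `ℚ(√-3)`, tree). [cite: ConradDiamondTaylor1999, Thm. 7.2.1 (proof, p. 553)] -/
theorem liftThree_of_stubs_surj (hmod3s : SigStubModThreeSurj)
    (hlift3 : ∀ (W : WeierstrassCurve ℚ) [W.IsElliptic] (ρ : ModPGaloisRep ℚ (ZMod 3) 2),
      W.IsTorsionGaloisRep 3 ρ → ρ.IsAbsIrreducibleOverSqrt (-3) → ¬ 9 ∣ W.conductorNorm ℤ →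
      ρ.IsModular → W.IsModularGaloisRepTate 3)
    (h32 : ∀ (W : WeierstrassCurve ℚ) [W.IsElliptic] [NeZero (W.conductorNorm ℤ)] (ℓ : ℕ)
      [Fact ℓ.Prime], W.IsModularGaloisRepTate ℓ → BCDT.IsModular W) :
    ∀ (W : WeierstrassCurve ℚ) [W.IsElliptic] [NeZero (W.conductorNorm ℤ)]
      (ρ : ModPGaloisRep ℚ (ZMod 3) 2), W.IsTorsionGaloisRep 3 ρ →
      Function.Surjective ρ → ¬ 9 ∣ W.conductorNorm ℤ → BCDT.IsModular W :=
  fun W _ _ ρ hρ hs h9 ↦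
    h32 W 3 (hlift3 W ρ hρ (isAbsIrreducibleOverSqrt_neg_three_of_surjective ρ hs) h9
      (hmod3s W ρ hρ hs))

/-- **The `3`–`5` switch with SURJECTIVE `ρ̄_{E',3}`** — CDT's switch from a curve, concluded in the
Shepherd-Barron–Taylor form. [cite: ConradDiamondTaylor1999, proof of Thm. 7.1.2 (p. 556)] -/
abbrev SigSwitchSurj : Prop :=
  ∀ (W : WeierstrassCurve ℚ) [W.IsElliptic], ¬ 27 ∣ W.conductorNorm ℤ →
    (∀ ρ₃ : ModPGaloisRep ℚ (ZMod 3) 2, W.IsTorsionGaloisRep 3 ρ₃ →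
      ¬ ρ₃.IsAbsIrreducibleOverSqrt (-3)) →
    ∀ (ρ : ModPGaloisRep ℚ (ZMod 5) 2), W.IsTorsionGaloisRep 5 ρ → ρ.IsAbsIrreducibleOverSqrt 5 →
    ∃ (W' : WeierstrassCurve ℚ) (_ : W'.IsElliptic), W'.IsTorsionGaloisRep 5 ρ ∧
      ∃ ρ₃' : ModPGaloisRep ℚ (ZMod 3) 2, W'.IsTorsionGaloisRep 3 ρ₃' ∧ Function.Surjective ρ₃'

/-- `SigSwitchSurj` is implied by the tree's named fact [SBT] verbatim (Weil pairing for the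
determinant). [cite: BCDTJAMS2001, §2.2] -/
theorem sigSwitchSurj_of_exists_isTorsionGaloisRep_five_and_surjective_three
    (hE : exists_isTorsionGaloisRep_five_and_surjective_three) : SigSwitchSurj := by
  intro W _ _ _ ρ hρ h5
  exact hE ρ h5.isAbsolutelyIrreducible
    (W.det_eq_modPCyclotomicCharacter_of_isTorsionGaloisRep_holds 5 ρ hρ)

/-- … and implies the registered `stub_switch` (= `BCDT.CDT_three_five_switch`). [folklore] -/
theorem CDT_three_five_switch_of_sigSwitchSurj (h : SigSwitchSurj) : CDT_three_five_switch := by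
  intro W _ h27 hB ρ hρ h5
  obtain ⟨W', hW', hρ', ρ₃, hρ₃, hs⟩ := h W h27 hB ρ hρ h5
  exact ⟨W', hW', hρ', ρ₃, hρ₃, isAbsIrreducibleOverSqrt_neg_three_of_surjective ρ₃ hs⟩

/-- The skeleton's `liftFive_of_stubs` (copied: the `Cruxes/` skeleton is not importable). [cite: ConradDiamondTaylor1999, Thm. 7.2.2 (proof, pp. 553–554)] -/
theorem liftFive_of_stubs'
    (hlift5 : ∀ (W : WeierstrassCurve ℚ) [W.IsElliptic] (ρ : ModPGaloisRep ℚ (ZMod 5) 2),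
      W.IsTorsionGaloisRep 5 ρ → ρ.IsAbsIrreducibleOverSqrt 5 → ¬ 25 ∣ W.conductorNorm ℤ →
      ρ.IsModular → W.IsModularGaloisRepTate 5)
    (h32 : ∀ (W : WeierstrassCurve ℚ) [W.IsElliptic] [NeZero (W.conductorNorm ℤ)] (ℓ : ℕ)
      [Fact ℓ.Prime], W.IsModularGaloisRepTate ℓ → BCDT.IsModular W) :
    ∀ (W : WeierstrassCurve ℚ) [W.IsElliptic] [NeZero (W.conductorNorm ℤ)],
      ¬ 25 ∣ W.conductorNorm ℤ →
      ∀ (ρ : ModPGaloisRep ℚ (ZMod 5) 2), W.IsTorsionGaloisRep 5 ρ →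
      ρ.IsAbsIrreducibleOverSqrt 5 → ρ.IsModular → BCDT.IsModular W :=
  fun W _ _ h25 ρ hρ hirr hmod ↦ h32 W 5 (hlift5 W ρ hρ hirr h25 hmod)

/-- The skeleton's `not_twentyFive_dvd_conductorNorm_freyCurve` (copied). [cite: BombieriGubler2006, Ex. 12.5.10] -/
theorem not_twentyFive_dvd_conductorNorm_freyCurve' {a b : ℤ} (hab : IsCoprime a b)
    (h0 : a * b * (a + b) ≠ 0) : ¬ 25 ∣ (freyCurve a b).conductorNorm ℤ := by
  intro h25
  have hdvd := conductorNorm_freyCurve_dvd_holds a b hab h0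
  have h25' : 25 ∣ 2 ^ 8 * (UniqueFactorizationMonoid.radical (a * b * (a + b))).natAbs :=
    h25.trans hdvd
  have hcop : Nat.Coprime 25 (2 ^ 8) := by norm_num
  have h25r : 25 ∣ (UniqueFactorizationMonoid.radical (a * b * (a + b))).natAbs :=
    hcop.dvd_of_dvd_mul_left h25'
  have hsq : Squarefree (UniqueFactorizationMonoid.radical (a * b * (a + b))).natAbs :=
    Int.squarefree_natAbs.mpr UniqueFactorizationMonoid.squarefree_radical
  have h5 : IsUnit (5 : ℕ) := hsq 5 ((show (5 : ℕ) * 5 = 25 by norm_num) ▸ h25r)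
  exact absurd (Nat.isUnit_iff.mp h5) (by norm_num)

/-- **Every Frey curve is modular, from the SURJECTIVE-`ρ̄` lifting statement `h1s`** — the
skeleton's `isModular_freyCurve_of_stubs` with three changes: (i) the corner is split off first
(`hcorner` = G4); (ii) in case A the absolutely irreducible `ρ̄_{E,3}` is surjective (`hsurjA` =
§2), so `h1s` applies; (iii) in case B the switch hands over a SURJECTIVE `ρ̄_{E',3}` (`h3s`), so
`h1s` applies to `E'`. [cite: ConradDiamondTaylor1999, Thm. 7.1.2 (proof, p. 556)] -/
theorem isModular_freyCurve_of_stubs_surj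
    (h1s : ∀ (W : WeierstrassCurve ℚ) [W.IsElliptic] [NeZero (W.conductorNorm ℤ)]
      (ρ : ModPGaloisRep ℚ (ZMod 3) 2), W.IsTorsionGaloisRep 3 ρ →
      Function.Surjective ρ → ¬ 9 ∣ W.conductorNorm ℤ → BCDT.IsModular W)
    (h2 : ∀ (W : WeierstrassCurve ℚ) [W.IsElliptic] [NeZero (W.conductorNorm ℤ)],
      ¬ 25 ∣ W.conductorNorm ℤ →
      ∀ (ρ : ModPGaloisRep ℚ (ZMod 5) 2), W.IsTorsionGaloisRep 5 ρ →
      ρ.IsAbsIrreducibleOverSqrt 5 → ρ.IsModular → BCDT.IsModular W)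
    (h3s : SigSwitchSurj)
    (h4a : ∀ a b : ℤ, IsCoprime a b → a * b * (a + b) ≠ 0 →
      ∀ ρ : ModPGaloisRep ℚ (ZMod 5) 2, (freyCurve a b).IsTorsionGaloisRep 5 ρ →
        FramedRep.IsIrreducible ρ)
    (h4b : ∀ (W : WeierstrassCurve ℚ) [W.IsElliptic], ¬ 25 ∣ W.conductorNorm ℤ →
      ∀ ρ : ModPGaloisRep ℚ (ZMod 5) 2, W.IsTorsionGaloisRep 5 ρ →
        FramedRep.IsIrreducible ρ → ρ.IsAbsIrreducibleOverSqrt 5)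
    (h6 : ∀ (W W' : WeierstrassCurve ℚ) [W.IsElliptic] [W'.IsElliptic]
      (ρ : ModPGaloisRep ℚ (ZMod 5) 2),
      W.IsTorsionGaloisRep 5 ρ → W'.IsTorsionGaloisRep 5 ρ →
      ¬ 9 ∣ W.conductorNorm ℤ → ¬ 9 ∣ W'.conductorNorm ℤ)
    (hsurjA : ∀ a b : ℤ, IsCoprime a b → a * b * (a + b) ≠ 0 → ¬ Corner a b →
      ∀ ρ₃ : ModPGaloisRep ℚ (ZMod 3) 2, (freyCurve a b).IsTorsionGaloisRep 3 ρ₃ →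
        FramedRep.IsIrreducible ρ₃ → Function.Surjective ρ₃)
    (hcorner : SigIsModularFreyCurveCorner)
    {a b : ℤ} (hab : IsCoprime a b) (h0 : a * b * (a + b) ≠ 0)
    [NeZero ((freyCurve a b).conductorNorm ℤ)] : BCDT.IsModular (freyCurve a b) := by
  haveI := isElliptic_freyCurve h0
  -- the CM corner: unconditional
  by_cases hc : Corner a b
  · exact hcorner a b hc
  have h9 : ¬ 9 ∣ (freyCurve a b).conductorNorm ℤ := not_nine_dvd_conductorNorm_freyCurve hab h0
  have h25 : ¬ 25 ∣ (freyCurve a b).conductorNorm ℤ :=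
    not_twentyFive_dvd_conductorNorm_freyCurve' hab h0
  -- case A: some framed model of `E[3]` is absolutely irreducible over `ℚ(√-3)` — then it is ONTO
  by_cases hA : ∃ ρ₃ : ModPGaloisRep ℚ (ZMod 3) 2,
      (freyCurve a b).IsTorsionGaloisRep 3 ρ₃ ∧ ρ₃.IsAbsIrreducibleOverSqrt (-3)
  · obtain ⟨ρ₃, hρ₃, h3i⟩ := hA
    exact h1s (freyCurve a b) ρ₃ hρ₃
      (hsurjA a b hab h0 hc ρ₃ hρ₃ h3i.isAbsolutelyIrreducible.isIrreducible) h9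
  -- case B: no framed model of `E[3]` is absolutely irreducible over `ℚ(√-3)`; work at `5`
  have hB : ∀ ρ₃ : ModPGaloisRep ℚ (ZMod 3) 2, (freyCurve a b).IsTorsionGaloisRep 3 ρ₃ →
      ¬ ρ₃.IsAbsIrreducibleOverSqrt (-3) := fun ρ₃ hρ₃ h3i ↦ hA ⟨ρ₃, hρ₃, h3i⟩
  have h27 : ¬ 27 ∣ (freyCurve a b).conductorNorm ℤ := fun h27 ↦ h9 (dvd_trans ⟨3, rfl⟩ h27)
  obtain ⟨ρ, hρ⟩ := (freyCurve a b).exists_isTorsionGaloisRep 5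
  have hirr : FramedRep.IsIrreducible ρ := h4a a b hab h0 ρ hρ
  have h5 : ρ.IsAbsIrreducibleOverSqrt 5 := h4b (freyCurve a b) h25 ρ hρ hirr
  -- the switch, with a SURJECTIVE `ρ̄_{E',3}`
  obtain ⟨W', hW', hρ', ρ₃', hρ₃', hs'⟩ := h3s (freyCurve a b) h27 hB ρ hρ h5
  haveI := hW'
  haveI : NeZero (W'.conductorNorm ℤ) := ⟨(conductorNorm_pos_holds W').ne'⟩
  have h9' : ¬ 9 ∣ W'.conductorNorm ℤ := h6 (freyCurve a b) W' ρ hρ hρ' h9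
  have hE' : BCDT.IsModular W' := h1s W' ρ₃' hρ₃' hs' h9'
  have hρmod : ρ.IsModular := hE'.isModular_of_isTorsionGaloisRep'' hρ'
  exact h2 (freyCurve a b) h25 ρ hρ h5 hρmod

/-- **The crux from the SURJECTIVE stub, concluded BY NAME** — kernel-checked composition: G1, G2,
G3 (a theorem), G4, `SigStubModThreeSurj` (F‴), the skeleton's S1b `stub_liftThree`, S2
`stub_liftFive`, S9 `stub_threeImpTwo` (as hypotheses: the `Cruxes/` skeleton is not importable),
the switch with surjective conclusion, and — as hypotheses `hfrey5`, `habsIrr5`, `hnine`, all three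
THEOREMS of the tree: the skeleton's `isIrreducible_freyCurve_five` (from the landed S5–S8), the
landed `Summit.ABC.ABC.Theorems.stub_absIrrSqrtFive` (p102499) and `stub_nineTransfer` (p110220),
quoted rather than imported because their import chains are not built on the farm at the time of
writing. [cite: ConradDiamondTaylor1999, Thm. 7.1.2 (proof, p. 556)] -/
theorem FreyModularity_of_surj (hG1 : SigThreeDvdCardOfΔNeCube) (hG2 : SigCornerOfΔFreyCurveEqCube)
    (hG4 : SigIsModularFreyCurveCorner) (hmod3s : SigStubModThreeSurj)
    (hlift3 : ∀ (W : WeierstrassCurve ℚ) [W.IsElliptic] (ρ : ModPGaloisRep ℚ (ZMod 3) 2),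
      W.IsTorsionGaloisRep 3 ρ → ρ.IsAbsIrreducibleOverSqrt (-3) → ¬ 9 ∣ W.conductorNorm ℤ →
      ρ.IsModular → W.IsModularGaloisRepTate 3)
    (hlift5 : ∀ (W : WeierstrassCurve ℚ) [W.IsElliptic] (ρ : ModPGaloisRep ℚ (ZMod 5) 2),
      W.IsTorsionGaloisRep 5 ρ → ρ.IsAbsIrreducibleOverSqrt 5 → ¬ 25 ∣ W.conductorNorm ℤ →
      ρ.IsModular → W.IsModularGaloisRepTate 5)
    (h32 : ∀ (W : WeierstrassCurve ℚ) [W.IsElliptic] [NeZero (W.conductorNorm ℤ)] (ℓ : ℕ)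
      [Fact ℓ.Prime], W.IsModularGaloisRepTate ℓ → BCDT.IsModular W)
    (hsw : SigSwitchSurj)
    (hfrey5 : ∀ a b : ℤ, IsCoprime a b → a * b * (a + b) ≠ 0 →
      ∀ ρ : ModPGaloisRep ℚ (ZMod 5) 2, (freyCurve a b).IsTorsionGaloisRep 5 ρ →
        FramedRep.IsIrreducible ρ)
    (habsIrr5 : ∀ (W : WeierstrassCurve ℚ) [W.IsElliptic], ¬ 25 ∣ W.conductorNorm ℤ →
      ∀ ρ : ModPGaloisRep ℚ (ZMod 5) 2, W.IsTorsionGaloisRep 5 ρ →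
        FramedRep.IsIrreducible ρ → ρ.IsAbsIrreducibleOverSqrt 5)
    (hnine : ∀ (W W' : WeierstrassCurve ℚ) [W.IsElliptic] [W'.IsElliptic]
      (ρ : ModPGaloisRep ℚ (ZMod 5) 2),
      W.IsTorsionGaloisRep 5 ρ → W'.IsTorsionGaloisRep 5 ρ →
      ¬ 9 ∣ W.conductorNorm ℤ → ¬ 9 ∣ W'.conductorNorm ℤ) :
    Summit.ABC.ABC.Theses.DefiniteXi.FreyModularity :=
  freyModularity_iff_forall_isModular_freyCurve.mpr
    fun _ _ hab h0 _ ↦ isModular_freyCurve_of_stubs_surj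
      (liftThree_of_stubs_surj hmod3s hlift3 h32) (liftFive_of_stubs' hlift5 h32) hsw
      hfrey5 habsIrr5 hnine
      (fun _ _ hab h0 hc _ hρ₃ hirr ↦ surjective_of_isIrreducible_freyCurve_three hG1 hG2
        hasSurjectiveModNGaloisRep_three_of_dvd_card hab h0 hc hρ₃ hirr)
      hG4 hab h0

/-- **The same with the switch fed by the catalogued [SBT] fact** — so, granted the three S-sized
helpers G1, G2, G4, the open inputs of the line are exactly {Langlands–Tunnell for SURJECTIVE
`ρ̄_{E,3}`, Diamond 1996 at `3` and at `5`, (3) ⇒ (2), [SBT]}. [cite: BCDTJAMS2001, §2.2] -/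
theorem FreyModularity_of_surj_SBT (hG1 : SigThreeDvdCardOfΔNeCube)
    (hG2 : SigCornerOfΔFreyCurveEqCube) (hG4 : SigIsModularFreyCurveCorner)
    (hmod3s : SigStubModThreeSurj)
    (hlift3 : ∀ (W : WeierstrassCurve ℚ) [W.IsElliptic] (ρ : ModPGaloisRep ℚ (ZMod 3) 2),
      W.IsTorsionGaloisRep 3 ρ → ρ.IsAbsIrreducibleOverSqrt (-3) → ¬ 9 ∣ W.conductorNorm ℤ →
      ρ.IsModular → W.IsModularGaloisRepTate 3)
    (hlift5 : ∀ (W : WeierstrassCurve ℚ) [W.IsElliptic] (ρ : ModPGaloisRep ℚ (ZMod 5) 2),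
      W.IsTorsionGaloisRep 5 ρ → ρ.IsAbsIrreducibleOverSqrt 5 → ¬ 25 ∣ W.conductorNorm ℤ →
      ρ.IsModular → W.IsModularGaloisRepTate 5)
    (h32 : ∀ (W : WeierstrassCurve ℚ) [W.IsElliptic] [NeZero (W.conductorNorm ℤ)] (ℓ : ℕ)
      [Fact ℓ.Prime], W.IsModularGaloisRepTate ℓ → BCDT.IsModular W)
    (hSBT : exists_isTorsionGaloisRep_five_and_surjective_three)
    (hfrey5 : ∀ a b : ℤ, IsCoprime a b → a * b * (a + b) ≠ 0 →
      ∀ ρ : ModPGaloisRep ℚ (ZMod 5) 2, (freyCurve a b).IsTorsionGaloisRep 5 ρ →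
        FramedRep.IsIrreducible ρ)
    (habsIrr5 : ∀ (W : WeierstrassCurve ℚ) [W.IsElliptic], ¬ 25 ∣ W.conductorNorm ℤ →
      ∀ ρ : ModPGaloisRep ℚ (ZMod 5) 2, W.IsTorsionGaloisRep 5 ρ →
        FramedRep.IsIrreducible ρ → ρ.IsAbsIrreducibleOverSqrt 5)
    (hnine : ∀ (W W' : WeierstrassCurve ℚ) [W.IsElliptic] [W'.IsElliptic]
      (ρ : ModPGaloisRep ℚ (ZMod 5) 2),
      W.IsTorsionGaloisRep 5 ρ → W'.IsTorsionGaloisRep 5 ρ →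
      ¬ 9 ∣ W.conductorNorm ℤ → ¬ 9 ∣ W'.conductorNorm ℤ) :
    Summit.ABC.ABC.Theses.DefiniteXi.FreyModularity :=
  FreyModularity_of_surj hG1 hG2 hG4 hmod3s hlift3 hlift5 h32
    (sigSwitchSurj_of_exists_isTorsionGaloisRep_five_and_surjective_three hSBT) hfrey5 habsIrr5 hnine

/-- **HEADLINE (gen 12, k = 3): the crux from Langlands–Tunnell AT SURJECTIVE `ρ̄` ONLY.**
`FreyModularity` follows from F‴ (`SigStubModThreeSurj`: every SURJECTIVE `ρ̄_{E,3}` is modular),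
the registered stubs S1b (`stub_liftThree`), S2 (`stub_liftFive`), S9 (`stub_threeImpTwo`), the
SBT-form switch (tree-named fact `exists_isTorsionGaloisRep_five_and_surjective_three`) and three
theorems of the tree quoted as hypotheses; the image-theory inputs G1–G4 are discharged by the
proofs above. [cite: Serre1972, §5.3, Prop. 15] [cite: Euler1770Algebra, Part II Ch. XV Art. 247]
[cite: Tunnell1983Congruent, p. 325] -/
theorem FreyModularity_of_stub_modThreeSurj (hmod3s : SigStubModThreeSurj)
    (hlift3 : ∀ (W : WeierstrassCurve ℚ) [W.IsElliptic] (ρ : ModPGaloisRep ℚ (ZMod 3) 2),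
      W.IsTorsionGaloisRep 3 ρ → ρ.IsAbsIrreducibleOverSqrt (-3) → ¬ 9 ∣ W.conductorNorm ℤ →
      ρ.IsModular → W.IsModularGaloisRepTate 3)
    (hlift5 : ∀ (W : WeierstrassCurve ℚ) [W.IsElliptic] (ρ : ModPGaloisRep ℚ (ZMod 5) 2),
      W.IsTorsionGaloisRep 5 ρ → ρ.IsAbsIrreducibleOverSqrt 5 → ¬ 25 ∣ W.conductorNorm ℤ →
      ρ.IsModular → W.IsModularGaloisRepTate 5)
    (h32 : ∀ (W : WeierstrassCurve ℚ) [W.IsElliptic] [NeZero (W.conductorNorm ℤ)] (ℓ : ℕ)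
      [Fact ℓ.Prime], W.IsModularGaloisRepTate ℓ → BCDT.IsModular W)
    (hSBT : exists_isTorsionGaloisRep_five_and_surjective_three)
    (hfrey5 : ∀ a b : ℤ, IsCoprime a b → a * b * (a + b) ≠ 0 →
      ∀ ρ : ModPGaloisRep ℚ (ZMod 5) 2, (freyCurve a b).IsTorsionGaloisRep 5 ρ →
        FramedRep.IsIrreducible ρ)
    (habsIrr5 : ∀ (W : WeierstrassCurve ℚ) [W.IsElliptic], ¬ 25 ∣ W.conductorNorm ℤ →
      ∀ ρ : ModPGaloisRep ℚ (ZMod 5) 2, W.IsTorsionGaloisRep 5 ρ →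
        FramedRep.IsIrreducible ρ → ρ.IsAbsIrreducibleOverSqrt 5)
    (hnine : ∀ (W W' : WeierstrassCurve ℚ) [W.IsElliptic] [W'.IsElliptic]
      (ρ : ModPGaloisRep ℚ (ZMod 5) 2),
      W.IsTorsionGaloisRep 5 ρ → W'.IsTorsionGaloisRep 5 ρ →
      ¬ 9 ∣ W.conductorNorm ℤ → ¬ 9 ∣ W'.conductorNorm ℤ) :
    Summit.ABC.ABC.Theses.DefiniteXi.FreyModularity :=
  FreyModularity_of_surj_SBT G1_three_dvd_card_range_of_Δ_ne_cube
    G2_corner_of_Δ_freyCurve_eq_cube G4_isModular_freyCurve_corner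
    hmod3s hlift3 hlift5 h32 hSBT hfrey5 habsIrr5 hnine

/-- Sanity: the same composition against the registered stub shape (`SigStubModThree` ⇒ F‴).
[folklore] -/
theorem FreyModularity_of_stub_modThree (hmod3 : SigStubModThree)
    (hlift3 : ∀ (W : WeierstrassCurve ℚ) [W.IsElliptic] (ρ : ModPGaloisRep ℚ (ZMod 3) 2),
      W.IsTorsionGaloisRep 3 ρ → ρ.IsAbsIrreducibleOverSqrt (-3) → ¬ 9 ∣ W.conductorNorm ℤ →
      ρ.IsModular → W.IsModularGaloisRepTate 3)
    (hlift5 : ∀ (W : WeierstrassCurve ℚ) [W.IsElliptic] (ρ : ModPGaloisRep ℚ (ZMod 5) 2),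
      W.IsTorsionGaloisRep 5 ρ → ρ.IsAbsIrreducibleOverSqrt 5 → ¬ 25 ∣ W.conductorNorm ℤ →
      ρ.IsModular → W.IsModularGaloisRepTate 5)
    (h32 : ∀ (W : WeierstrassCurve ℚ) [W.IsElliptic] [NeZero (W.conductorNorm ℤ)] (ℓ : ℕ)
      [Fact ℓ.Prime], W.IsModularGaloisRepTate ℓ → BCDT.IsModular W)
    (hSBT : exists_isTorsionGaloisRep_five_and_surjective_three)
    (hfrey5 : ∀ a b : ℤ, IsCoprime a b → a * b * (a + b) ≠ 0 →
      ∀ ρ : ModPGaloisRep ℚ (ZMod 5) 2, (freyCurve a b).IsTorsionGaloisRep 5 ρ →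
        FramedRep.IsIrreducible ρ)
    (habsIrr5 : ∀ (W : WeierstrassCurve ℚ) [W.IsElliptic], ¬ 25 ∣ W.conductorNorm ℤ →
      ∀ ρ : ModPGaloisRep ℚ (ZMod 5) 2, W.IsTorsionGaloisRep 5 ρ →
        FramedRep.IsIrreducible ρ → ρ.IsAbsIrreducibleOverSqrt 5)
    (hnine : ∀ (W W' : WeierstrassCurve ℚ) [W.IsElliptic] [W'.IsElliptic]
      (ρ : ModPGaloisRep ℚ (ZMod 5) 2),
      W.IsTorsionGaloisRep 5 ρ → W'.IsTorsionGaloisRep 5 ρ →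
      ¬ 9 ∣ W.conductorNorm ℤ → ¬ 9 ∣ W'.conductorNorm ℤ) :
    Summit.ABC.ABC.Theses.DefiniteXi.FreyModularity :=
  FreyModularity_of_surj_SBT G1_three_dvd_card_range_of_Δ_ne_cube
    G2_corner_of_Δ_freyCurve_eq_cube G4_isModular_freyCurve_corner
    (sigStubModThreeSurj_of_sigStubModThree hmod3) hlift3 hlift5 h32 hSBT hfrey5 habsIrr5 hnine

end Summit.ABC.ABC.Cruxes.FreyModularity.StubIdeasModThree3G12

end
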